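import Summits.CriticalPhenomena.PercolationContinuityZ3.Theorems.PercNearOneGluingNoHeavyLowerTailSuperTerminalP3LamPortPiecesTwo
import HarnessLib

/-!
# `P3_λ` (`λ ≥ 3/2`): the exact cell-level criterion for gluing a piece that misses `a` (or `s`)

Support file for crux `stmt-CriticalPhenomena-4575` (`NoHeavyLowerTail`), seat `prim-l12-p1` gen 33 (`--supports stmt-CriticalPhenomena-4575`);
sequel of `…SuperTerminalP3LamPortPieces` / `…PortPiecesTwo` / `…BFreePieces`.  No definitions, no sorries, standard axioms.

Row `P3_λ`: `μ(F)·μ(c ↔ T) ≤ λ·μ(F ∩ c ↔ T)`, `F = {s↔a} ∩ {s↮b}`, `T = {s,a,b}` (sharp conjectured constant `λ = 3/2`).  A piece whose pairs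
avoid `a` is a 3-terminal gadget `H` on `{s,b,c}`; its down-set vector is `e = (n, n, n+p_bc, n+p_bc, n+p_sc, n+p_sc, n, n+p_sb)` in terms of
its 3-point law `(n, p_sb, p_sc, p_bc, p_all)` (`dvec_aFreePiece`).  In the cells `σ, ζ, τ, ξ_a` of `d` the row of the product reads
`Row_λ(d ⊙ e) = K_σ·σ + K_ζ·ζ + K_τ·τ + K_ξ·ξ_a` with `K_ζ = (n+p_bc)(λ−1+γ·ic)`, `K_τ = (n+p_sc)(λ−1+γ·ic)`, `K_ξ = p_sc(λ−1+γ·ic)` (all `≥ 0`)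
and `K_σ = (p_sc+p_bc)(λ−1+γ·ic) − n(1−γ·ic)` (`γ = d7`, `ic = n + p_sb`), while the row of `d` is `R = (λ−1+γ)(ζ+τ) − (1−γ)σ`; hence

* `dvec_p3lam_mul_aFree` — **`Core(d) ∧ Row_λ(d) ∧ C(γ; H) ⟹ Row_λ(d ⊙ e)`**, where `C(γ; H)` is the pair of inequalities
  `(λ−1+γ)·(−K_σ) ≤ (1−γ)·K_ζ` and `(λ−1+γ)·(−K_σ) ≤ (1−γ)·K_τ` — by Farkas duality this is the EXACT criterion for `Row_λ(d ⊙ e)` to hold for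
  every `d` in the cone `{cells ≥ 0, R ≥ 0}` (the face multiplier is forced to vanish);
* `dvec_p3lam_mul_sFree` — the mirror statement for a piece missing `s` (the row is symmetric under `s ↔ a`, i.e. `d5 ↔ d6`);
* `dvec_aFreePiece`, `dvec_sFreePiece` — the shapes.
`C(1; H)` is the 3-terminal row `P(s↮b)·P(c ↔ {s,b}) ≤ λ·P(s↮b, c ↔ {s,b})` (= `P3_λ` of `H` plus a pendant edge `s–a`); `C(γ; H)` for all
`γ ∈ [0,1]` is CONJECTURE C_λ of memo `FROM-prim-l12-p1-g33-PORT-PART-SHARP-ROW.md` §9 (no violation on ≈ 3·10⁴ random weighted graphs with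
≤ 7 vertices; kit census `j237471`); it FAILS for abstract 3-point laws obeying Harris, the diamond inequality and the 3-terminal row (so real
3-point laws satisfy more than those), which is the gen-31/32 obstruction seen from the piece's side.  The assembly is `…PortPiecesFour`.
-/

namespace Summit.CriticalPhenomena.PercolationContinuityZ3.Theorems.SuperTerminalP3LamAFreePieces

open MeasureTheory Set Filter
open Literature.Probability.Percolation Literature.Probability.Percolation.PartitionGluing
open Literature.Probability.LatticeModels (prodBernoulli)
open SuperTerminalDownsets SuperTerminalDownsetEvents SuperTerminalP3LamDvec SuperTerminalP3LamPortPieces SuperTerminalP3LamPortPiecesTwo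
open scoped Classical

variable {V : Type*} [Fintype V]

/-- The ORDER RELATIONS of a down-set vector (as in `…SuperTerminalP3LamDvec`).  Local notation only. -/
local notation "Core[" x0 "," x1 "," x2 "," x3 "," x4 "," x5 "," x6 "," x7 "]" =>
  (((0 : ℝ) ≤ x0 ∧ x0 ≤ x1 ∧ x0 ≤ x3 ∧ x0 ≤ x5 ∧ x0 ≤ x6 ∧ (0 : ℝ) ≤ x7 ∧ x7 ≤ 1 ∧
      (0 : ℝ) ≤ x2 - x3 - x1 + x0 ∧ (0 : ℝ) ≤ x4 - x5 - x6 + x0 - x1 + x0) : Prop)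

/-- The row `P3_λ` in down-set coordinates (as in `…SuperTerminalP3LamDvec`).  Local notation only. -/
local notation "RowLam[" lam ";" x0 "," x1 "," x2 "," x3 "," x4 "," x5 "," x6 "," x7 "]" =>
  (((x2 - x3 + x4 - x5 - x6 - x1 + 2 * x0) * (1 - x7) ≤ lam * (x2 - x3 + x4 - x5 - x6 - 2 * x1 + 3 * x0)) : Prop)

/-- The gluing criterion `C(γ; n, N₂, N₄, ic)` of an `a`-free piece with `n = e0`, `N₂ = n + p_bc = e2`, `N₄ = n + p_sc = e4`, `ic = n + p_sb = e7`
at port-isolation level `γ`: `(λ−1+γ)·(n(1−γ·ic) − (λ−1+γ·ic)(N₂+N₄−2n)) ≤ (1−γ)(λ−1+γ·ic)·N` for `N ∈ {N₂, N₄}`.  Local notation only. -/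
local notation "Crit[" lam ";" g ";" n "," N2 "," N4 "," ic "]" =>
  (((lam - 1 + g) * (n * (1 - g * ic) - (lam - 1 + g * ic) * (N2 + N4 - 2 * n)) ≤ (1 - g) * (lam - 1 + g * ic) * N2 ∧
      (lam - 1 + g) * (n * (1 - g * ic) - (lam - 1 + g * ic) * (N2 + N4 - 2 * n)) ≤ (1 - g) * (lam - 1 + g * ic) * N4) : Prop)

/-! ## Cell algebra -/

/-- **Gluing an `a`-free piece (cell level, exact criterion).**  For `λ > 1`: let `d` satisfy the order relations and the row `P3_λ`, and let
`e = (n, n, N₂, N₂, N₄, N₄, n, ic)` (`0 ≤ n ≤ N₂`, `n ≤ N₄`, `0 ≤ ic`) satisfy the criterion `C(d7; n, N₂, N₄, ic)`.  Then `d ⊙ e`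
satisfies `P3_λ`.  Proof: `Row_λ(d⊙e) = K_σσ + K_ζζ + K_ττ + K_ξξ_a`; if `K_σ ≥ 0` every term is nonnegative, otherwise
`(1−γ)·Row_λ(d⊙e) ≥ (−K_σ)·(R − (λ−1+γ)(ζ+τ)) + (1−γ)(K_ζζ + K_ττ) ≥ 0` by `R ≥ 0` and the criterion. [this work] -/
theorem dvec_p3lam_mul_aFree {lam d0 d1 d2 d3 d4 d5 d6 d7 e0 e1 e2 e3 e4 e5 e6 e7 : ℝ} (hlam : 1 < lam)
    (hd : Core[d0, d1, d2, d3, d4, d5, d6, d7]) (hP : RowLam[lam; d0, d1, d2, d3, d4, d5, d6, d7])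
    (h1 : e1 = e0) (h3 : e3 = e2) (h5 : e5 = e4) (h6 : e6 = e0)
    (he0 : 0 ≤ e0) (he02 : e0 ≤ e2) (he04 : e0 ≤ e4) (he7 : 0 ≤ e7)
    (hC : Crit[lam; d7; e0, e2, e4, e7]) :
    RowLam[lam; d0 * e0, d1 * e1, d2 * e2, d3 * e3, d4 * e4, d5 * e5, d6 * e6, d7 * e7] := by
  rw [h1, h3, h5, h6]
  obtain ⟨g0, g1, g3, g5, g6, g7, g71, gζ, gτ⟩ := hd
  obtain ⟨hC2, hC4⟩ := hC
  -- the row of `d` in cells: `R = (λ−1+γ)(ζ+τ) − (1−γ)σ ≥ 0`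
  have hR : 0 ≤ (lam - 1 + d7) * ((d2 - d3 - d1 + d0) + (d4 - d5 - d6 + d0 - d1 + d0)) - (1 - d7) * (d1 - d0) := by
    have e : (lam - 1 + d7) * ((d2 - d3 - d1 + d0) + (d4 - d5 - d6 + d0 - d1 + d0)) - (1 - d7) * (d1 - d0) =
        lam * (d2 - d3 + d4 - d5 - d6 - 2 * d1 + 3 * d0) - (d2 - d3 + d4 - d5 - d6 - d1 + 2 * d0) * (1 - d7) := by ring
    rw [e]; linarith
  have hPos : 0 < lam - 1 + d7 * e7 := by
    have := mul_nonneg g7 he7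
    linarith
  -- the target in cells
  have key : lam * (d2 * e2 - d3 * e2 + d4 * e4 - d5 * e4 - d6 * e0 - 2 * (d1 * e0) + 3 * (d0 * e0)) -
      (d2 * e2 - d3 * e2 + d4 * e4 - d5 * e4 - d6 * e0 - d1 * e0 + 2 * (d0 * e0)) * (1 - d7 * e7) =
      e2 * (lam - 1 + d7 * e7) * (d2 - d3 - d1 + d0) + e4 * (lam - 1 + d7 * e7) * (d4 - d5 - d6 + d0 - d1 + d0) +
        (e4 - e0) * (lam - 1 + d7 * e7) * (d6 - d0) -
        (e0 * (1 - d7 * e7) - (lam - 1 + d7 * e7) * (e2 + e4 - 2 * e0)) * (d1 - d0) := by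
    ring
  have tζ : 0 ≤ e2 * (lam - 1 + d7 * e7) * (d2 - d3 - d1 + d0) := mul_nonneg (mul_nonneg (he0.trans he02) hPos.le) gζ
  have tτ : 0 ≤ e4 * (lam - 1 + d7 * e7) * (d4 - d5 - d6 + d0 - d1 + d0) := mul_nonneg (mul_nonneg (he0.trans he04) hPos.le) gτ
  have tξ : 0 ≤ (e4 - e0) * (lam - 1 + d7 * e7) * (d6 - d0) := mul_nonneg (mul_nonneg (sub_nonneg.2 he04) hPos.le) (sub_nonneg.2 g6)
  suffices hT : 0 ≤ lam * (d2 * e2 - d3 * e2 + d4 * e4 - d5 * e4 - d6 * e0 - 2 * (d1 * e0) + 3 * (d0 * e0)) -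
      (d2 * e2 - d3 * e2 + d4 * e4 - d5 * e4 - d6 * e0 - d1 * e0 + 2 * (d0 * e0)) * (1 - d7 * e7) by
    linarith
  rw [key]
  set X : ℝ := e0 * (1 - d7 * e7) - (lam - 1 + d7 * e7) * (e2 + e4 - 2 * e0) with hX
  by_cases hX0 : X ≤ 0
  · -- every term is nonnegative
    have tσ : 0 ≤ (-X) * (d1 - d0) := mul_nonneg (neg_nonneg.2 hX0) (sub_nonneg.2 g1)
    nlinarith [tσ, tζ, tτ, tξ]
  · have hX1 : 0 < X := not_le.1 hX0
    -- `(1−γ)·X·σ ≤ X·(λ−1+γ)(ζ+τ) ≤ (1−γ)(K_ζ ζ + K_τ τ)`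
    have s1 : X * ((1 - d7) * (d1 - d0)) ≤ X * ((lam - 1 + d7) * ((d2 - d3 - d1 + d0) + (d4 - d5 - d6 + d0 - d1 + d0))) :=
      mul_le_mul_of_nonneg_left (by linarith) hX1.le
    have s2 : (lam - 1 + d7) * X * (d2 - d3 - d1 + d0) ≤ (1 - d7) * (lam - 1 + d7 * e7) * e2 * (d2 - d3 - d1 + d0) :=
      mul_le_mul_of_nonneg_right hC2 gζ
    have s3 : (lam - 1 + d7) * X * (d4 - d5 - d6 + d0 - d1 + d0) ≤
        (1 - d7) * (lam - 1 + d7 * e7) * e4 * (d4 - d5 - d6 + d0 - d1 + d0) :=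
      mul_le_mul_of_nonneg_right hC4 gτ
    have tB : 0 ≤ (1 - d7) * ((e4 - e0) * (lam - 1 + d7 * e7) * (d6 - d0)) := mul_nonneg (sub_nonneg.2 g71) tξ
    -- hence `(1−γ)·T ≥ (1−γ)·K_ξ ξ_a ≥ 0`
    have hBT : 0 ≤ (1 - d7) * (e2 * (lam - 1 + d7 * e7) * (d2 - d3 - d1 + d0) +
        e4 * (lam - 1 + d7 * e7) * (d4 - d5 - d6 + d0 - d1 + d0) + (e4 - e0) * (lam - 1 + d7 * e7) * (d6 - d0) - X * (d1 - d0)) := by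
      have e : (1 - d7) * (e2 * (lam - 1 + d7 * e7) * (d2 - d3 - d1 + d0) +
          e4 * (lam - 1 + d7 * e7) * (d4 - d5 - d6 + d0 - d1 + d0) + (e4 - e0) * (lam - 1 + d7 * e7) * (d6 - d0) - X * (d1 - d0)) =
          ((1 - d7) * (lam - 1 + d7 * e7) * e2 * (d2 - d3 - d1 + d0) - (lam - 1 + d7) * X * (d2 - d3 - d1 + d0)) +
          ((1 - d7) * (lam - 1 + d7 * e7) * e4 * (d4 - d5 - d6 + d0 - d1 + d0) - (lam - 1 + d7) * X * (d4 - d5 - d6 + d0 - d1 + d0)) +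
          (X * ((lam - 1 + d7) * ((d2 - d3 - d1 + d0) + (d4 - d5 - d6 + d0 - d1 + d0))) - X * ((1 - d7) * (d1 - d0))) +
          (1 - d7) * ((e4 - e0) * (lam - 1 + d7 * e7) * (d6 - d0)) := by ring
      rw [e]
      linarith [s1, s2, s3, tB]
    by_cases hB : d7 = 1
    · -- `γ = 1`: the criterion forces `X ≤ 0`
      exfalso
      have h := hC2
      rw [hB] at h
      have e1' : (lam - 1 + 1) * X = lam * X := by ring
      have e2' : (1 - (1 : ℝ)) * (lam - 1 + 1 * e7) * e2 = 0 := by ring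
      rw [e1', e2'] at h
      have : 0 < lam * X := mul_pos (by linarith) hX1
      linarith
    · have hBpos : 0 < 1 - d7 := sub_pos.2 (lt_of_le_of_ne g71 hB)
      by_contra hneg
      have hneg' := not_le.1 hneg
      have := mul_neg_of_pos_of_neg hBpos hneg'
      linarith

/-- **Gluing an `s`-free piece** — the mirror image (`d5 ↔ d6`, `e5 ↔ e6`) of `dvec_p3lam_mul_aFree`: the shape is now
`e = (n, n, N₂, N₂, N₄, n, N₄, ic)` with `N₂ = n + p_bc`, `N₄ = n + p_ac`, `ic = n + p_ab`. [this work] -/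
theorem dvec_p3lam_mul_sFree {lam d0 d1 d2 d3 d4 d5 d6 d7 e0 e1 e2 e3 e4 e5 e6 e7 : ℝ} (hlam : 1 < lam)
    (hd : Core[d0, d1, d2, d3, d4, d5, d6, d7]) (hP : RowLam[lam; d0, d1, d2, d3, d4, d5, d6, d7])
    (h1 : e1 = e0) (h3 : e3 = e2) (h5 : e5 = e0) (h6 : e6 = e4)
    (he0 : 0 ≤ e0) (he02 : e0 ≤ e2) (he04 : e0 ≤ e4) (he7 : 0 ≤ e7)
    (hC : Crit[lam; d7; e0, e2, e4, e7]) :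
    RowLam[lam; d0 * e0, d1 * e1, d2 * e2, d3 * e3, d4 * e4, d5 * e5, d6 * e6, d7 * e7] := by
  obtain ⟨g0, g1, g3, g5, g6, g7, g71, gζ, gτ⟩ := hd
  have hd' : Core[d0, d1, d2, d3, d4, d6, d5, d7] := ⟨g0, g1, g3, g6, g5, g7, g71, gζ, by linarith⟩
  have hP' : RowLam[lam; d0, d1, d2, d3, d4, d6, d5, d7] := by linarith
  have h := dvec_p3lam_mul_aFree (e5 := e6) (e6 := e5) hlam hd' hP' h1 h3 h6 h5 he0 he02 he04 he7 hC
  linarith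

/-! ## Shapes -/

section Shape
variable {s a b c : V}

/-- **`a`-free shape.**  If the pairs of `u` avoid `a`, then in the down-set coordinates `e0..e7` of `u`: `e1 = e0`, `e3 = e2`, `e5 = e4`,
`e6 = e0` (all four reduce to 3-point events of `{s,b,c}`, `a` being a.s. isolated). [this work] -/
theorem dvec_aFreePiece (u : Sym2 V → unitInterval) (hd : s ≠ a ∧ s ≠ b ∧ s ≠ c ∧ a ≠ b ∧ a ≠ c ∧ b ≠ c)
    (ha : ∀ x : V, x ≠ a → (u s(a, x) : ℝ) = 0) :
    (prodBernoulli u).real ((openConn s b)ᶜ ∩ (openConn s c)ᶜ ∩ (openConn a b)ᶜ ∩ (openConn a c)ᶜ ∩ (openConn b c)ᶜ : Set (BondConfig V)) =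
        (prodBernoulli u).real
          ((openConn s a)ᶜ ∩ (openConn s b)ᶜ ∩ (openConn s c)ᶜ ∩ (openConn a b)ᶜ ∩ (openConn a c)ᶜ ∩ (openConn b c)ᶜ : Set (BondConfig V)) ∧
      (prodBernoulli u).real ((openConn s a)ᶜ ∩ (openConn s b)ᶜ ∩ (openConn s c)ᶜ ∩ (openConn a b)ᶜ ∩ (openConn a c)ᶜ : Set (BondConfig V)) =
        (prodBernoulli u).real ((openConn s b)ᶜ ∩ (openConn s c)ᶜ ∩ (openConn a b)ᶜ ∩ (openConn a c)ᶜ : Set (BondConfig V)) ∧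
      (prodBernoulli u).real ((openConn s a)ᶜ ∩ (openConn s b)ᶜ ∩ (openConn a b)ᶜ ∩ (openConn a c)ᶜ ∩ (openConn b c)ᶜ : Set (BondConfig V)) =
        (prodBernoulli u).real ((openConn s b)ᶜ ∩ (openConn a b)ᶜ ∩ (openConn b c)ᶜ : Set (BondConfig V)) ∧
      (prodBernoulli u).real ((openConn s a)ᶜ ∩ (openConn s b)ᶜ ∩ (openConn s c)ᶜ ∩ (openConn a b)ᶜ ∩ (openConn b c)ᶜ : Set (BondConfig V)) =
        (prodBernoulli u).real
          ((openConn s a)ᶜ ∩ (openConn s b)ᶜ ∩ (openConn s c)ᶜ ∩ (openConn a b)ᶜ ∩ (openConn a c)ᶜ ∩ (openConn b c)ᶜ : Set (BondConfig V)) := by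
  -- `a` is a.s. isolated
  have hae : ∀ᵐ ω ∂(prodBernoulli u), (¬ (openGraph ω).Reachable a s ∧ ¬ (openGraph ω).Reachable s a) ∧
      (¬ (openGraph ω).Reachable a b ∧ ¬ (openGraph ω).Reachable b a) ∧ (¬ (openGraph ω).Reachable a c ∧ ¬ (openGraph ω).Reachable c a) := by
    filter_upwards [ae_sep_of_isolated u ha hd.1, ae_sep_of_isolated u ha hd.2.2.2.1.symm, ae_sep_of_isolated u ha hd.2.2.2.2.1.symm]
      with ω h1 h2 h3
    exact ⟨h1, h2, h3⟩
  have Y : ∀ (X Z : Set (BondConfig V)), (∀ ω : BondConfig V, ((¬ (openGraph ω).Reachable a s ∧ ¬ (openGraph ω).Reachable s a) ∧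
      (¬ (openGraph ω).Reachable a b ∧ ¬ (openGraph ω).Reachable b a) ∧ (¬ (openGraph ω).Reachable a c ∧ ¬ (openGraph ω).Reachable c a)) →
      (ω ∈ X ↔ ω ∈ Z)) → (prodBernoulli u).real X = (prodBernoulli u).real Z := fun X Z hX =>
    real_congr_of_ae u (by filter_upwards [hae] with ω hω; exact hX ω hω)
  refine ⟨?_, ?_, ?_, ?_⟩
  · exact Y _ _ fun ω hω => by simp only [mem_inter_iff, mem_compl_iff, openConn, mem_setOf_eq]; tauto
  · exact Y _ _ fun ω hω => by simp only [mem_inter_iff, mem_compl_iff, openConn, mem_setOf_eq]; tauto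
  · exact Y _ _ fun ω hω => by simp only [mem_inter_iff, mem_compl_iff, openConn, mem_setOf_eq]; tauto
  · exact Y _ _ fun ω hω => by simp only [mem_inter_iff, mem_compl_iff, openConn, mem_setOf_eq]; tauto

/-- **`s`-free shape.**  If the pairs of `u` avoid `s`, then in the down-set coordinates `e0..e7` of `u`: `e1 = e0`, `e3 = e2`, `e5 = e0`,
`e6 = e4`. [this work] -/
theorem dvec_sFreePiece (u : Sym2 V → unitInterval) (hd : s ≠ a ∧ s ≠ b ∧ s ≠ c ∧ a ≠ b ∧ a ≠ c ∧ b ≠ c)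
    (hs : ∀ x : V, x ≠ s → (u s(s, x) : ℝ) = 0) :
    (prodBernoulli u).real ((openConn s b)ᶜ ∩ (openConn s c)ᶜ ∩ (openConn a b)ᶜ ∩ (openConn a c)ᶜ ∩ (openConn b c)ᶜ : Set (BondConfig V)) =
        (prodBernoulli u).real
          ((openConn s a)ᶜ ∩ (openConn s b)ᶜ ∩ (openConn s c)ᶜ ∩ (openConn a b)ᶜ ∩ (openConn a c)ᶜ ∩ (openConn b c)ᶜ : Set (BondConfig V)) ∧
      (prodBernoulli u).real ((openConn s a)ᶜ ∩ (openConn s b)ᶜ ∩ (openConn s c)ᶜ ∩ (openConn a b)ᶜ ∩ (openConn a c)ᶜ : Set (BondConfig V)) =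
        (prodBernoulli u).real ((openConn s b)ᶜ ∩ (openConn s c)ᶜ ∩ (openConn a b)ᶜ ∩ (openConn a c)ᶜ : Set (BondConfig V)) ∧
      (prodBernoulli u).real ((openConn s a)ᶜ ∩ (openConn s b)ᶜ ∩ (openConn a b)ᶜ ∩ (openConn a c)ᶜ ∩ (openConn b c)ᶜ : Set (BondConfig V)) =
        (prodBernoulli u).real
          ((openConn s a)ᶜ ∩ (openConn s b)ᶜ ∩ (openConn s c)ᶜ ∩ (openConn a b)ᶜ ∩ (openConn a c)ᶜ ∩ (openConn b c)ᶜ : Set (BondConfig V)) ∧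
      (prodBernoulli u).real ((openConn s a)ᶜ ∩ (openConn s b)ᶜ ∩ (openConn s c)ᶜ ∩ (openConn a b)ᶜ ∩ (openConn b c)ᶜ : Set (BondConfig V)) =
        (prodBernoulli u).real ((openConn s b)ᶜ ∩ (openConn a b)ᶜ ∩ (openConn b c)ᶜ : Set (BondConfig V)) := by
  have hae : ∀ᵐ ω ∂(prodBernoulli u), (¬ (openGraph ω).Reachable s a ∧ ¬ (openGraph ω).Reachable a s) ∧
      (¬ (openGraph ω).Reachable s b ∧ ¬ (openGraph ω).Reachable b s) ∧ (¬ (openGraph ω).Reachable s c ∧ ¬ (openGraph ω).Reachable c s) := by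
    filter_upwards [ae_sep_of_isolated u hs hd.1.symm, ae_sep_of_isolated u hs hd.2.1.symm, ae_sep_of_isolated u hs hd.2.2.1.symm]
      with ω h1 h2 h3
    exact ⟨h1, h2, h3⟩
  have Y : ∀ (X Z : Set (BondConfig V)), (∀ ω : BondConfig V, ((¬ (openGraph ω).Reachable s a ∧ ¬ (openGraph ω).Reachable a s) ∧
      (¬ (openGraph ω).Reachable s b ∧ ¬ (openGraph ω).Reachable b s) ∧ (¬ (openGraph ω).Reachable s c ∧ ¬ (openGraph ω).Reachable c s)) →
      (ω ∈ X ↔ ω ∈ Z)) → (prodBernoulli u).real X = (prodBernoulli u).real Z := fun X Z hX =>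
    real_congr_of_ae u (by filter_upwards [hae] with ω hω; exact hX ω hω)
  refine ⟨?_, ?_, ?_, ?_⟩
  · exact Y _ _ fun ω hω => by simp only [mem_inter_iff, mem_compl_iff, openConn, mem_setOf_eq]; tauto
  · exact Y _ _ fun ω hω => by simp only [mem_inter_iff, mem_compl_iff, openConn, mem_setOf_eq]; tauto
  · exact Y _ _ fun ω hω => by simp only [mem_inter_iff, mem_compl_iff, openConn, mem_setOf_eq]; tauto
  · exact Y _ _ fun ω hω => by simp only [mem_inter_iff, mem_compl_iff, openConn, mem_setOf_eq]; tauto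

end Shape

end Summit.CriticalPhenomena.PercolationContinuityZ3.Theorems.SuperTerminalP3LamAFreePieces
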